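import Literature.Analysis.SegalBargmann.HermiteSumOperators
import Literature.Analysis.SegalBargmann.HermiteCoefficientBound
import Mathlib.Analysis.SpecialFunctions.JapaneseBracket
import HarnessLib

/-!
# Polynomial growth of the sup-norm of Hermite expansions (Folland 1989, §1.7; Reed–Simon I, Thm V.13)

Topic `Analysis/SegalBargmann`; namespace `Literature.Analysis.SegalBargmann`.  Continuation of
`Literature.Analysis.SegalBargmann.HermiteSumOperators`.  For a finite Hermite sum `F ∈ V_d = span {h_β : |β| ≤ d}`
on `ℝ^σ` (`IsHermiteSum (degLE d) F`), `n = |σ|`: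

* §1 `∫ ‖Σ_{k∈K} u_k‖² ≤ |K| Σ_k ∫ ‖u_k‖²`; the weight `W = 1 + |x|²` (`oneAddNormSqCLM`) maps `V_d → V_{d+2}` with
  `∫ ‖W F‖² ≤ (2 + 2n²(d+1)(d+2)) ∫ ‖F‖²`, hence `W^m : V_d → V_{d+2m}` with
  `∫ ‖W^m F‖² ≤ (2 + 2n²(d+2m)²)^m ∫ ‖F‖²` (`IsHermiteSum.integral_norm_sq_oneAddNormSqCLM_pow_le`) — the
  WEIGHTED-`L²` GROWTH BOUND, polynomial in the degree;
* §2 `𝓕⁴ = 1` on Hermite sums, so `F = 𝓕 G` with `G = 𝓕³ F ∈ V_d`, `∫‖G‖² = ∫‖F‖²`, and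
  `‖F(x)‖ ≤ ‖G‖_{L¹} = ∫ (1+|y|²)^{−m} · ‖(W^m G)(y)‖ dy ≤ ‖(1+|y|²)^{−m}‖_{L²} · ‖W^m G‖_{L²}` (Cauchy–Schwarz, `4m > n`):
  the SUP-NORM BOUND `‖F‖_∞ ≤ K_{σ,m} (2 + 2n²(d+2m)²)^{m/2} ‖F‖_{L²}` (`IsHermiteSum.norm_apply_le`), and in rounded
  form `‖F‖_∞ ≤ C_σ (d+1)^{n+1} ‖F‖_{L²}` on `V_d`, `‖h_α‖_∞ ≤ C_σ (|α|+1)^{n+1}` for every Hermite function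
  (`exists_norm_apply_le_of_isHermiteSum`, `exists_norm_hermiteSchwartz_herm_le`).

This is the pointwise half of the estimates making `(c_α) ↦ Σ_α c_α h_α` continuous from rapidly decreasing sequences
to `𝒮(ℝⁿ)` (the `N`-representation theorem, Reed–Simon I Thm V.13; Folland §1.7 uses the same weighted-`L²` route).
Everything is proved from Mathlib and the imported tree files; no cited fact is used as a hypothesis.

## References

* G. B. Folland, *Harmonic Analysis in Phase Space*, Annals of Mathematics Studies 122, Princeton UP (1989), §1.7.
  [cite: Folland1989, §1.7]
* M. Reed, B. Simon, *Methods of Modern Mathematical Physics I*, Theorem V.13 and the Appendix to §V.3.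

## Provenance

Written for the tree under the LEAN-IN-TREE rule (2026-08-18) by the pub-hodgecm formalisation cell (model-construction
sub-cell, seat mc-binder-2).
-/

set_option autoImplicit false

noncomputable section

open MvPolynomial Complex SchwartzMap MeasureTheory FourierTransform Module
open scoped BigOperators Real FourierTransform

namespace Literature.Analysis.SegalBargmann

variable {σ : Type*} [Fintype σ] [DecidableEq σ]

/-! ## §1  The weight `1 + |x|²` on `V_d` -/

section Weight

variable {F : 𝓢(EuclideanSpace ℝ σ, ℂ)}

omit [DecidableEq σ] in
/-- **`∫ ‖Σ_{k∈K} u_k‖² ≤ |K| · Σ_{k∈K} ∫ ‖u_k‖²`** for Schwartz functions (Cauchy–Schwarz). [folklore] -/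
theorem integral_norm_sq_sum_le {ι : Type*} (K : Finset ι) (u : ι → 𝓢(EuclideanSpace ℝ σ, ℂ)) :
    ∫ x : EuclideanSpace ℝ σ, ‖(∑ k ∈ K, u k) x‖ ^ 2 ≤
      K.card * ∑ k ∈ K, ∫ x : EuclideanSpace ℝ σ, ‖u k x‖ ^ 2 := by
  rw [← integral_finsetSum K (fun k _ => integrable_norm_sq (u k)), ← integral_const_mul]
  refine integral_mono (integrable_norm_sq _)
    ((integrable_finsetSum K fun k _ => integrable_norm_sq (u k)).const_mul _) fun x => ?_
  show ‖(∑ k ∈ K, u k) x‖ ^ 2 ≤ K.card * ∑ k ∈ K, ‖u k x‖ ^ 2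
  rw [sum_apply]
  calc ‖∑ k ∈ K, u k x‖ ^ 2 ≤ (∑ k ∈ K, ‖u k x‖) ^ 2 := by
        gcongr
        exact norm_sum_le _ _
    _ ≤ K.card * ∑ k ∈ K, ‖u k x‖ ^ 2 := sq_sum_le_card_mul_sum_sq

omit [DecidableEq σ] in
/-- `(1 + |x|²) f = f + Σ_j x_j (x_j f)`. [folklore] -/
theorem oneAddNormSqCLM_eq_add_sum (f : 𝓢(EuclideanSpace ℝ σ, ℂ)) :
    oneAddNormSqCLM f = f + ∑ j : σ, coordMulCLM j (coordMulCLM j f) := by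
  rw [oneAddNormSqCLM, add_apply, ContinuousLinearMap.id_apply, sum_apply]
  rfl

omit [DecidableEq σ] in
/-- `((1 + |x|²)^m f)(x) = (1 + ‖x‖²)^m · f(x)`. [folklore] -/
theorem oneAddNormSqCLM_pow_apply (m : ℕ) (f : 𝓢(EuclideanSpace ℝ σ, ℂ)) (x : EuclideanSpace ℝ σ) :
    (oneAddNormSqCLM ^ m) f x = (((1 + ‖x‖ ^ 2) ^ m : ℝ) : ℂ) * f x := by
  induction m with
  | zero =>
      rw [pow_zero, pow_zero, Complex.ofReal_one, one_mul]
      rfl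
  | succ m ih =>
      rw [pow_succ']
      change oneAddNormSqCLM ((oneAddNormSqCLM ^ m) f) x = _
      rw [oneAddNormSqCLM_apply, ih, pow_succ]
      push_cast
      ring

/-- **`1 + |x|² : V_d → V_{d+2}`**. [cite: Folland1989, (1.82)] -/
theorem IsHermiteSum.map_oneAddNormSqCLM_degLE {d : ℕ} (hF : IsHermiteSum (degLE d) F) :
    IsHermiteSum (degLE (d + 2)) (oneAddNormSqCLM F) := by
  rw [oneAddNormSqCLM_eq_add_sum]
  exact (hF.mono (degLE_mono (by omega))).add
    (IsHermiteSum.sum _ _ fun j _ => (hF.map_coordMulCLM_degLE j).map_coordMulCLM_degLE j)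

/-- **`∫ ‖(1+|x|²) F‖² ≤ (2 + 2n²(d+1)(d+2)) ∫ ‖F‖²` on `V_d`** (`n = |σ|`; from `∫‖x_j F‖² ≤ (d+1)/π ∫‖F‖²` twice,
`π ≥ 1`, and `∫‖Σ‖² ≤ |·| Σ∫‖·‖²`). [cite: Folland1989, §1.7] -/
theorem IsHermiteSum.integral_norm_sq_oneAddNormSqCLM_le {d : ℕ} (hF : IsHermiteSum (degLE d) F) :
    ∫ x : EuclideanSpace ℝ σ, ‖oneAddNormSqCLM F x‖ ^ 2 ≤
      (2 + 2 * (Fintype.card σ : ℝ) ^ 2 * (((d : ℝ) + 1) * ((d : ℝ) + 2))) *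
        ∫ x : EuclideanSpace ℝ σ, ‖F x‖ ^ 2 := by
  set n : ℝ := (Fintype.card σ : ℝ) with hn
  have h0 : 0 ≤ ∫ x : EuclideanSpace ℝ σ, ‖F x‖ ^ 2 := integral_nonneg fun _ => by positivity
  have hπ : (1 : ℝ) ≤ π := by linarith [Real.pi_gt_three]
  -- each `x_j x_j F`
  have hj : ∀ j : σ, ∫ x : EuclideanSpace ℝ σ, ‖coordMulCLM j (coordMulCLM j F) x‖ ^ 2 ≤
      (((d : ℝ) + 1) * ((d : ℝ) + 2)) * ∫ x : EuclideanSpace ℝ σ, ‖F x‖ ^ 2 := fun j => by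
    have h1 : ∫ x : EuclideanSpace ℝ σ, ‖coordMulCLM j F x‖ ^ 2 ≤
        ((d : ℝ) + 1) * ∫ x : EuclideanSpace ℝ σ, ‖F x‖ ^ 2 :=
      (hF.integral_norm_sq_coordMulCLM_le_degLE j).trans
        (mul_le_mul_of_nonneg_right (div_le_self (by positivity) hπ) h0)
    have h2 : ∫ x : EuclideanSpace ℝ σ, ‖coordMulCLM j (coordMulCLM j F) x‖ ^ 2 ≤
        ((d : ℝ) + 2) * ∫ x : EuclideanSpace ℝ σ, ‖coordMulCLM j F x‖ ^ 2 := by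
      refine ((hF.map_coordMulCLM_degLE j).integral_norm_sq_coordMulCLM_le_degLE j).trans
        (mul_le_mul_of_nonneg_right ?_ (integral_nonneg fun _ => by positivity))
      push_cast
      calc ((d : ℝ) + 1 + 1) / π ≤ (d : ℝ) + 1 + 1 := div_le_self (by positivity) hπ
        _ = (d : ℝ) + 2 := by ring
    calc ∫ x : EuclideanSpace ℝ σ, ‖coordMulCLM j (coordMulCLM j F) x‖ ^ 2
        ≤ ((d : ℝ) + 2) * ∫ x : EuclideanSpace ℝ σ, ‖coordMulCLM j F x‖ ^ 2 := h2
      _ ≤ ((d : ℝ) + 2) * (((d : ℝ) + 1) * ∫ x : EuclideanSpace ℝ σ, ‖F x‖ ^ 2) := by gcongr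
      _ = (((d : ℝ) + 1) * ((d : ℝ) + 2)) * ∫ x : EuclideanSpace ℝ σ, ‖F x‖ ^ 2 := by ring
  -- their sum over `j`
  have hG : ∫ x : EuclideanSpace ℝ σ, ‖(∑ j : σ, coordMulCLM j (coordMulCLM j F)) x‖ ^ 2 ≤
      n * (n * ((((d : ℝ) + 1) * ((d : ℝ) + 2)) * ∫ x : EuclideanSpace ℝ σ, ‖F x‖ ^ 2)) := by
    refine (integral_norm_sq_sum_le Finset.univ _).trans ?_
    rw [Finset.card_univ, ← hn]
    gcongr
    calc ∑ j : σ, ∫ x : EuclideanSpace ℝ σ, ‖coordMulCLM j (coordMulCLM j F) x‖ ^ 2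
        ≤ ∑ _j : σ, (((d : ℝ) + 1) * ((d : ℝ) + 2)) * ∫ x : EuclideanSpace ℝ σ, ‖F x‖ ^ 2 :=
          Finset.sum_le_sum fun j _ => hj j
      _ = n * ((((d : ℝ) + 1) * ((d : ℝ) + 2)) * ∫ x : EuclideanSpace ℝ σ, ‖F x‖ ^ 2) := by
          rw [Finset.sum_const, Finset.card_univ, nsmul_eq_mul]
  rw [oneAddNormSqCLM_eq_add_sum]
  calc ∫ x : EuclideanSpace ℝ σ, ‖(F + ∑ j : σ, coordMulCLM j (coordMulCLM j F)) x‖ ^ 2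
      ≤ 2 * (∫ x : EuclideanSpace ℝ σ, ‖F x‖ ^ 2) +
          2 * ∫ x : EuclideanSpace ℝ σ, ‖(∑ j : σ, coordMulCLM j (coordMulCLM j F)) x‖ ^ 2 :=
        integral_norm_sq_add_le _ _
    _ ≤ 2 * (∫ x : EuclideanSpace ℝ σ, ‖F x‖ ^ 2) +
          2 * (n * (n * ((((d : ℝ) + 1) * ((d : ℝ) + 2)) * ∫ x : EuclideanSpace ℝ σ, ‖F x‖ ^ 2))) := by
        gcongr
    _ = (2 + 2 * n ^ 2 * (((d : ℝ) + 1) * ((d : ℝ) + 2))) * ∫ x : EuclideanSpace ℝ σ, ‖F x‖ ^ 2 := by ring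

/-- **`(1 + |x|²)^m : V_d → V_{d+2m}`**. [cite: Folland1989, (1.82)] -/
theorem IsHermiteSum.map_oneAddNormSqCLM_pow_degLE {d : ℕ} (hF : IsHermiteSum (degLE d) F) (m : ℕ) :
    IsHermiteSum (degLE (d + 2 * m)) ((oneAddNormSqCLM ^ m) F) := by
  induction m with
  | zero => simpa using hF
  | succ m ih =>
      rw [pow_succ', show d + 2 * (m + 1) = d + 2 * m + 2 by ring]
      exact ih.map_oneAddNormSqCLM_degLE

/-- **Weighted-`L²` growth bound**: `∫ ‖(1+|x|²)^m F‖² ≤ (2 + 2n²(d+2m)²)^m ∫ ‖F‖²` for `F ∈ V_d` (`n = |σ|`).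
[cite: Folland1989, §1.7] -/
theorem IsHermiteSum.integral_norm_sq_oneAddNormSqCLM_pow_le {d : ℕ} (hF : IsHermiteSum (degLE d) F) (m : ℕ) :
    ∫ x : EuclideanSpace ℝ σ, ‖(oneAddNormSqCLM ^ m) F x‖ ^ 2 ≤
      (2 + 2 * (Fintype.card σ : ℝ) ^ 2 * ((d : ℝ) + 2 * (m : ℝ)) ^ 2) ^ m *
        ∫ x : EuclideanSpace ℝ σ, ‖F x‖ ^ 2 := by
  set n : ℝ := (Fintype.card σ : ℝ) with hn
  have h0 : 0 ≤ ∫ x : EuclideanSpace ℝ σ, ‖F x‖ ^ 2 := integral_nonneg fun _ => by positivity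
  induction m with
  | zero => simp
  | succ m ih =>
      have hstep := (hF.map_oneAddNormSqCLM_pow_degLE m).integral_norm_sq_oneAddNormSqCLM_le
      rw [← hn] at hstep
      simp only [Nat.cast_add, Nat.cast_mul, Nat.cast_ofNat, Nat.cast_one] at hstep ⊢
      rw [pow_succ']
      change ∫ x : EuclideanSpace ℝ σ, ‖oneAddNormSqCLM ((oneAddNormSqCLM ^ m) F) x‖ ^ 2 ≤ _
      refine hstep.trans ?_
      set A : ℝ := 2 + 2 * n ^ 2 * ((d : ℝ) + 2 * ((m : ℝ) + 1)) ^ 2 with hA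
      have hdm : (0 : ℝ) ≤ (d : ℝ) + 2 * (m : ℝ) := by positivity
      have hn2 : (0 : ℝ) ≤ 2 * n ^ 2 := by positivity
      -- the one-step constant and the old constant are both `≤ A`
      have hc1 : 2 + 2 * n ^ 2 * (((d : ℝ) + 2 * (m : ℝ) + 1) * ((d : ℝ) + 2 * (m : ℝ) + 2)) ≤ A := by
        rw [hA]
        have : ((d : ℝ) + 2 * (m : ℝ) + 1) * ((d : ℝ) + 2 * (m : ℝ) + 2) ≤ ((d : ℝ) + 2 * ((m : ℝ) + 1)) ^ 2 := by
          nlinarith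
        nlinarith [mul_le_mul_of_nonneg_left this hn2]
      have hc2 : 2 + 2 * n ^ 2 * ((d : ℝ) + 2 * (m : ℝ)) ^ 2 ≤ A := by
        rw [hA]
        have : ((d : ℝ) + 2 * (m : ℝ)) ^ 2 ≤ ((d : ℝ) + 2 * ((m : ℝ) + 1)) ^ 2 := by nlinarith
        nlinarith [mul_le_mul_of_nonneg_left this hn2]
      have hB0 : (0 : ℝ) ≤ 2 + 2 * n ^ 2 * ((d : ℝ) + 2 * (m : ℝ)) ^ 2 := by positivity
      have hA0 : (0 : ℝ) ≤ A := hB0.trans hc2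
      have hWm0 : 0 ≤ ∫ x : EuclideanSpace ℝ σ, ‖(oneAddNormSqCLM ^ m) F x‖ ^ 2 :=
        integral_nonneg fun _ => by positivity
      calc (2 + 2 * n ^ 2 * (((d : ℝ) + 2 * (m : ℝ) + 1) * ((d : ℝ) + 2 * (m : ℝ) + 2))) *
            ∫ x : EuclideanSpace ℝ σ, ‖(oneAddNormSqCLM ^ m) F x‖ ^ 2
          ≤ A * ((2 + 2 * n ^ 2 * ((d : ℝ) + 2 * (m : ℝ)) ^ 2) ^ m *
              ∫ x : EuclideanSpace ℝ σ, ‖F x‖ ^ 2) :=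
            mul_le_mul hc1 ih hWm0 hA0
        _ ≤ A * (A ^ m * ∫ x : EuclideanSpace ℝ σ, ‖F x‖ ^ 2) := by
            gcongr
        _ = A ^ (m + 1) * ∫ x : EuclideanSpace ℝ σ, ‖F x‖ ^ 2 := by ring

end Weight

/-! ## §2  The sup-norm bound on `V_d` -/

section SupNorm

variable {S : Finset (σ →₀ ℕ)} {F : 𝓢(EuclideanSpace ℝ σ, ℂ)}

/-- `𝓕⁴ h_β = h_β` (`𝓕 h_β = (−i)^{|β|} h_β`). [cite: Folland1989, §1.7] -/
theorem fourier_pow_four_hermiteSchwartz_herm (β : σ →₀ ℕ) :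
    𝓕 (𝓕 (𝓕 (𝓕 (hermiteSchwartz (herm β))))) = hermiteSchwartz (herm β) := by
  have hI4 : (-I : ℂ) ^ 4 = 1 := by
    rw [show (4 : ℕ) = 2 * 2 from rfl, pow_mul, neg_sq, I_sq]
    norm_num
  rw [fourier_hermiteSchwartz_herm, FourierSMul.fourier_smul, fourier_hermiteSchwartz_herm, smul_smul,
    FourierSMul.fourier_smul, fourier_hermiteSchwartz_herm, smul_smul, FourierSMul.fourier_smul,
    fourier_hermiteSchwartz_herm, smul_smul, ← pow_add, ← pow_add, ← pow_add,
    show β.degree + β.degree + β.degree + β.degree = 4 * β.degree by ring, pow_mul, hI4, one_pow, one_smul]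

/-- **`𝓕⁴ = 1` on Hermite sums.** [cite: Folland1989, §1.7] -/
theorem IsHermiteSum.fourier_pow_four (hF : IsHermiteSum S F) : 𝓕 (𝓕 (𝓕 (𝓕 F))) = F := by
  calc 𝓕 (𝓕 (𝓕 (𝓕 F)))
      = 𝓕 (𝓕 (𝓕 (𝓕 (∑ β ∈ S, hermiteCoeff β F • hermiteSchwartz (herm β))))) := by rw [hF]
    _ = ∑ β ∈ S, hermiteCoeff β F • 𝓕 (𝓕 (𝓕 (𝓕 (hermiteSchwartz (herm β))))) := by
        simp only [FourierTransform.fourier_sum, FourierSMul.fourier_smul]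
    _ = F := by
        simp_rw [fourier_pow_four_hermiteSchwartz_herm]
        exact hF

omit [DecidableEq σ] in
/-- The Cauchy–Schwarz weight: `(1 + ‖y‖²)^{−m}` is square integrable on `ℝ^σ` when `4m > |σ|`
(Mathlib `integrable_rpow_neg_one_add_norm_sq`). [folklore] -/
theorem integrable_one_add_norm_sq_rpow_neg_sq {m : ℕ} (hm : (Fintype.card σ : ℝ) < 4 * m) :
    Integrable (fun y : EuclideanSpace ℝ σ => (((1 : ℝ) + ‖y‖ ^ 2) ^ (-(m : ℝ))) ^ 2) := by
  have h := integrable_rpow_neg_one_add_norm_sq (E := EuclideanSpace ℝ σ) (μ := volume) (r := 4 * m)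
    (by rwa [finrank_euclideanSpace])
  refine h.congr (Filter.Eventually.of_forall fun y => ?_)
  have hy : (0 : ℝ) ≤ 1 + ‖y‖ ^ 2 := by positivity
  show ((1 : ℝ) + ‖y‖ ^ 2) ^ (-(4 * (m : ℝ)) / 2) = (((1 : ℝ) + ‖y‖ ^ 2) ^ (-(m : ℝ))) ^ 2
  rw [← Real.rpow_mul_natCast hy]
  congr 1
  push_cast
  ring

/-- **Sup-norm bound on `V_d`**: for `F ∈ V_d = span {h_β : |β| ≤ d}` and `4m > n = |σ|`,
`‖F(x)‖ ≤ ‖(1+|y|²)^{−m}‖_{L²} · (2 + 2n²(d+2m)²)^{m/2} · ‖F‖_{L²}` for every `x`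
(`F = 𝓕 G`, `G = 𝓕³F ∈ V_d`; `‖𝓕 G‖_∞ ≤ ‖G‖_{L¹}`; Cauchy–Schwarz against `(1+|y|²)^{−m}`; the weighted-`L²` bound).
[cite: Folland1989, §1.7] -/
theorem IsHermiteSum.norm_apply_le {d : ℕ} (hF : IsHermiteSum (degLE d) F) {m : ℕ}
    (hm : (Fintype.card σ : ℝ) < 4 * m) (x : EuclideanSpace ℝ σ) :
    ‖F x‖ ≤ Real.sqrt (∫ y : EuclideanSpace ℝ σ, (((1 : ℝ) + ‖y‖ ^ 2) ^ (-(m : ℝ))) ^ 2) *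
      Real.sqrt ((2 + 2 * (Fintype.card σ : ℝ) ^ 2 * ((d : ℝ) + 2 * (m : ℝ)) ^ 2) ^ m *
        ∫ y : EuclideanSpace ℝ σ, ‖F y‖ ^ 2) := by
  -- `F = 𝓕 G` with `G = 𝓕³ F ∈ V_d`, `∫‖G‖² = ∫‖F‖²`
  set G : 𝓢(EuclideanSpace ℝ σ, ℂ) := 𝓕 (𝓕 (𝓕 F)) with hGdef
  have hG : IsHermiteSum (degLE d) G := hF.map_fourier.map_fourier.map_fourier
  have hGF : 𝓕 G = F := hF.fourier_pow_four
  have hGnorm : ∫ y : EuclideanSpace ℝ σ, ‖G y‖ ^ 2 = ∫ y : EuclideanSpace ℝ σ, ‖F y‖ ^ 2 := by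
    rw [hGdef, hF.map_fourier.map_fourier.integral_norm_sq_fourier, hF.map_fourier.integral_norm_sq_fourier,
      hF.integral_norm_sq_fourier]
  -- `‖F x‖ ≤ ‖G‖_{L¹}`
  have h1 : ‖F x‖ ≤ ∫ y : EuclideanSpace ℝ σ, ‖G y‖ := by
    have h := SchwartzMap.norm_fourier_apply_le_toLp_one G x
    rwa [hGF, SchwartzMap.norm_toLp_one] at h
  -- insert the weight
  set w : EuclideanSpace ℝ σ → ℝ := fun y => ((1 : ℝ) + ‖y‖ ^ 2) ^ (-(m : ℝ)) with hw
  have hpos : ∀ y : EuclideanSpace ℝ σ, (0 : ℝ) < 1 + ‖y‖ ^ 2 := fun y => by positivity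
  have hWm : ∀ y : EuclideanSpace ℝ σ, ‖(oneAddNormSqCLM ^ m) G y‖ = (1 + ‖y‖ ^ 2) ^ m * ‖G y‖ := fun y => by
    rw [oneAddNormSqCLM_pow_apply, norm_mul, Complex.norm_real, Real.norm_of_nonneg (pow_nonneg (hpos y).le m)]
  have h2 : ∫ y : EuclideanSpace ℝ σ, ‖G y‖ =
      ∫ y : EuclideanSpace ℝ σ, w y * ‖(oneAddNormSqCLM ^ m) G y‖ := by
    refine integral_congr_ae (Filter.Eventually.of_forall fun y => ?_)
    show ‖G y‖ = ((1 : ℝ) + ‖y‖ ^ 2) ^ (-(m : ℝ)) * ‖(oneAddNormSqCLM ^ m) G y‖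
    rw [hWm, Real.rpow_neg (hpos y).le, Real.rpow_natCast, ← mul_assoc,
      inv_mul_cancel₀ (pow_ne_zero m (hpos y).ne'), one_mul]
  -- Cauchy–Schwarz
  have hw_cont : Continuous w :=
    Continuous.rpow_const (by fun_prop) fun y => Or.inl (hpos y).ne'
  have hw_memLp : MemLp w (ENNReal.ofReal 2) volume := by
    rw [show ENNReal.ofReal 2 = (2 : ENNReal) by norm_num]
    exact (memLp_two_iff_integrable_sq hw_cont.aestronglyMeasurable).mpr
      (integrable_one_add_norm_sq_rpow_neg_sq hm)
  have hCS := integral_mul_le_Lp_mul_Lq_of_nonneg (μ := (volume : Measure (EuclideanSpace ℝ σ)))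
    Real.HolderConjugate.two_two
    (Filter.Eventually.of_forall fun y => (Real.rpow_nonneg (hpos y).le _ : 0 ≤ w y))
    (Filter.Eventually.of_forall fun y => norm_nonneg ((oneAddNormSqCLM ^ m) G y))
    hw_memLp (memLp_two_norm ((oneAddNormSqCLM ^ m) G))
  -- the weighted `L²` bound for `G`
  have h4 := hG.integral_norm_sq_oneAddNormSqCLM_pow_le m
  rw [hGnorm] at h4
  calc ‖F x‖ ≤ ∫ y : EuclideanSpace ℝ σ, ‖G y‖ := h1
    _ = ∫ y : EuclideanSpace ℝ σ, w y * ‖(oneAddNormSqCLM ^ m) G y‖ := h2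
    _ ≤ (∫ y : EuclideanSpace ℝ σ, w y ^ (2 : ℝ)) ^ (1 / (2 : ℝ)) *
          (∫ y : EuclideanSpace ℝ σ, ‖(oneAddNormSqCLM ^ m) G y‖ ^ (2 : ℝ)) ^ (1 / (2 : ℝ)) := hCS
    _ = Real.sqrt (∫ y : EuclideanSpace ℝ σ, w y ^ 2) *
          Real.sqrt (∫ y : EuclideanSpace ℝ σ, ‖(oneAddNormSqCLM ^ m) G y‖ ^ 2) := by
        simp_rw [Real.rpow_two, Real.sqrt_eq_rpow]
    _ ≤ Real.sqrt (∫ y : EuclideanSpace ℝ σ, w y ^ 2) *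
          Real.sqrt ((2 + 2 * (Fintype.card σ : ℝ) ^ 2 * ((d : ℝ) + 2 * (m : ℝ)) ^ 2) ^ m *
            ∫ y : EuclideanSpace ℝ σ, ‖F y‖ ^ 2) :=
        mul_le_mul_of_nonneg_left (Real.sqrt_le_sqrt h4) (Real.sqrt_nonneg _)

/-- **`‖F‖_∞ ≤ C_σ (d+1)^{n+1} ‖F‖_{L²}` on `V_d`** (`n = |σ|`, `C_σ` depending only on `σ`): the sup-norm of a
Hermite expansion of degree `≤ d` grows at most polynomially in `d` (the previous bound with `m = n + 1`, rounded).
[cite: Folland1989, §1.7] -/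
theorem exists_norm_apply_le_of_isHermiteSum :
    ∃ C : ℝ, 0 ≤ C ∧ ∀ (d : ℕ) (F : 𝓢(EuclideanSpace ℝ σ, ℂ)), IsHermiteSum (degLE d) F →
      ∀ x : EuclideanSpace ℝ σ,
        ‖F x‖ ≤ C * ((d : ℝ) + 1) ^ (Fintype.card σ + 1) *
          Real.sqrt (∫ y : EuclideanSpace ℝ σ, ‖F y‖ ^ 2) := by
  set n : ℕ := Fintype.card σ with hn
  set m : ℕ := n + 1 with hmdef
  have hm : (n : ℝ) < 4 * m := by
    rw [hmdef]
    push_cast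
    linarith [(Nat.cast_nonneg n : (0 : ℝ) ≤ n)]
  set K : ℝ := Real.sqrt (∫ y : EuclideanSpace ℝ σ, (((1 : ℝ) + ‖y‖ ^ 2) ^ (-(m : ℝ))) ^ 2) with hK
  set c : ℝ := 2 + 8 * (n : ℝ) ^ 2 * (m : ℝ) ^ 2 with hc
  refine ⟨K * Real.sqrt (c ^ m), mul_nonneg (Real.sqrt_nonneg _) (Real.sqrt_nonneg _), fun d F hF x => ?_⟩
  have h := hF.norm_apply_le hm x
  rw [← hn, ← hK] at h
  have hI0 : 0 ≤ ∫ y : EuclideanSpace ℝ σ, ‖F y‖ ^ 2 := integral_nonneg fun _ => by positivity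
  have hd0 : (0 : ℝ) ≤ (d : ℝ) + 1 := by positivity
  have hm1 : (1 : ℝ) ≤ m := by
    rw [hmdef]
    push_cast
    linarith [(Nat.cast_nonneg n : (0 : ℝ) ≤ n)]
  -- `2 + 2n²(d+2m)² ≤ c (d+1)²`
  have hB : 2 + 2 * (n : ℝ) ^ 2 * ((d : ℝ) + 2 * (m : ℝ)) ^ 2 ≤ c * ((d : ℝ) + 1) ^ 2 := by
    rw [hc]
    have h1 : (d : ℝ) + 2 * (m : ℝ) ≤ 2 * (m : ℝ) * ((d : ℝ) + 1) := by
      nlinarith [(Nat.cast_nonneg d : (0 : ℝ) ≤ d)]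
    have h2 : ((d : ℝ) + 2 * (m : ℝ)) ^ 2 ≤ (2 * (m : ℝ) * ((d : ℝ) + 1)) ^ 2 := by
      gcongr
    have h3 : (2 : ℝ) ≤ 2 * ((d : ℝ) + 1) ^ 2 := by nlinarith
    nlinarith [mul_le_mul_of_nonneg_left h2 (by positivity : (0 : ℝ) ≤ 2 * (n : ℝ) ^ 2)]
  have hBm : (2 + 2 * (n : ℝ) ^ 2 * ((d : ℝ) + 2 * (m : ℝ)) ^ 2) ^ m ≤ c ^ m * (((d : ℝ) + 1) ^ m) ^ 2 := by
    calc (2 + 2 * (n : ℝ) ^ 2 * ((d : ℝ) + 2 * (m : ℝ)) ^ 2) ^ m ≤ (c * ((d : ℝ) + 1) ^ 2) ^ m :=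
          pow_le_pow_left₀ (by positivity) hB m
      _ = c ^ m * (((d : ℝ) + 1) ^ m) ^ 2 := by rw [mul_pow, ← pow_mul, ← pow_mul, Nat.mul_comm]
  calc ‖F x‖ ≤ K * Real.sqrt ((2 + 2 * (n : ℝ) ^ 2 * ((d : ℝ) + 2 * (m : ℝ)) ^ 2) ^ m *
        ∫ y : EuclideanSpace ℝ σ, ‖F y‖ ^ 2) := h
    _ ≤ K * Real.sqrt (c ^ m * (((d : ℝ) + 1) ^ m) ^ 2 * ∫ y : EuclideanSpace ℝ σ, ‖F y‖ ^ 2) := by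
        gcongr
    _ = K * Real.sqrt (c ^ m) * ((d : ℝ) + 1) ^ m * Real.sqrt (∫ y : EuclideanSpace ℝ σ, ‖F y‖ ^ 2) := by
        rw [Real.sqrt_mul (by positivity), Real.sqrt_mul (by positivity), Real.sqrt_sq (by positivity)]
        ring

/-- **Polynomial growth of the sup-norm of the Hermite functions**: `‖h_α(x)‖ ≤ C_σ (|α| + 1)^{n+1}` for every
multi-index `α` and every `x ∈ ℝ^σ` (`n = |σ|`, `‖h_α‖_{L²} = 1`). [cite: Folland1989, §1.7] -/
theorem exists_norm_hermiteSchwartz_herm_le :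
    ∃ C : ℝ, 0 ≤ C ∧ ∀ (α : σ →₀ ℕ) (x : EuclideanSpace ℝ σ),
      ‖hermiteSchwartz (herm α) x‖ ≤ C * ((α.degree : ℝ) + 1) ^ (Fintype.card σ + 1) := by
  obtain ⟨C, hC0, hC⟩ := exists_norm_apply_le_of_isHermiteSum (σ := σ)
  refine ⟨C, hC0, fun α x => ?_⟩
  have h := hC α.degree (hermiteSchwartz (herm α)) (isHermiteSum_herm_degLE α) x
  rwa [integral_norm_sq_hermiteSchwartz_herm, Real.sqrt_one, mul_one] at h

end SupNorm

end Literature.Analysis.SegalBargmann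

end
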